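/-
HONEST FRAMING: certified error envelopes and provably optimal rounding/accumulation schemes for
low-precision formats under stated cost models; every table by two implementations; no hardware
or vendor claims.
-/
import Summits.Ventures.CertifiedArithmetic.LowPrec.OptDemotionRoutingR33Arith
import Summits.Ventures.CertifiedArithmetic.LowPrec.OptDemotionRoutingPhi3

/-!
# The demotion law (Theorem T8), part 10j-b: opt's R33 — the two-bit top-level `E`-rows — FOR EVERY `q`

opt gen 15 §5b (R33): `E2(j,k): x_(j-1,k-1) ≤ (1-u) x_(j,k) + (1+u) 2^-j x_(k-j,q-j)` — the e-side
split target `(E_u)(β = ½, B = 2^-j + 2^-k)` — holds for EVERY tree, every `q ≥ 4` and every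
`2 ≤ j < k ≤ q-1` (`treeBR_eRow2`).  opt had the exact branch identities L1, L2, L4 and
L3 = LEMMA Φ3 + (MC) (threefam/r33_verify.py) with the remaining sign conditions checked for
`q ≤ 30`; here the four branch certificates are the all-`q` lemmas of part 10j-a (multipliers
polynomial after clearing `1-t`, `t`; signs on the whole box), LEMMA Φ3 is part 10i
(`treeBR_phi3`, every `q`), the node rule of the three-bit left-hand side is part 10g
`treeBR_three_node_le`, the right-hand options are part 10i-0 `treeBR_triple_node_ge`, and the
rows used are R31 (10c `treeBR_twoFam_le`), (MC) (10g/10i-0), gap convexity (10d) and (M).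
By value (parts 9d/10e units), with homogeneity and one (M) step exactly as in part 10c
`treeBRv_eRow_singleBit`: **`eRow_twoBit`** — `ERow q t u k (2^i + 2^i')` for every tree, every
`q ≥ 4`, every level `k + 2 ≤ q` and all `i' < i < k` (opt's R34 for popcount 2).  With parts
10c/10e every e-side row of opt's split with `popcount(B) ≤ 2` holds at `ρ = u`, at every level,
for every tree and every `q`.
-/

namespace Summit.Ventures.CertifiedArithmetic.LowPrec.Opt

open Literature.ComputerArithmetic.JeannerodRump2018
open Literature.ComputerArithmetic.JeannerodRump2018.SumTree

section R33

variable {q : ℕ}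

/-- **R33 FOR EVERY `q`** (opt gen 15 §5b, E2(j,k)): for `q ≥ 4`, `2 ≤ j < k ≤ q-1` and every tree,
`BR_t{0,-(j-1),-(k-1)} ≤ (1-u) BR_t{0,-j,-k} + (1+u) 2^-j BR_t{0,-(k-j),-(q-j)}`, `u = 2^-q`. -/
theorem treeBR_eRow2 (hq : 4 ≤ q) {j k : ℕ} (hj : 2 ≤ j) (hjk : j < k) (hkq : k + 1 ≤ q) :
    ∀ t : SumTree,
    treeBR q t {0, -((j : ℤ) - 1), -((k : ℤ) - 1)} ≤
      (1 - unitRoundoff q) * treeBR q t {0, -(j : ℤ), -(k : ℤ)} +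
        (1 + unitRoundoff q) * (2 : ℚ) ^ (-(j : ℤ)) * treeBR q t {0, -((k : ℤ) - j), -((q : ℤ) - j)} := by
  have hq1 : 1 ≤ q := by omega
  obtain ⟨c, hc⟩ : ∃ c : ℕ, (c : ℤ) = (q : ℤ) - k := ⟨q - k, by omega⟩
  obtain ⟨d, hd⟩ : ∃ d : ℕ, (d : ℤ) = (q : ℤ) - j := ⟨q - j, by omega⟩
  have hc1 : 1 ≤ c := by omega
  have hcd : c < d := by omega
  have hdq : d + 2 ≤ q := by omega
  rw [← hd]
  set u := unitRoundoff q with hudef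
  set m : ℚ := (2 : ℚ) ^ (-(k : ℤ)) with hmdef
  set t : ℚ := (2 : ℚ) ^ (-(j : ℤ)) with htdef
  ------------------------------------------------------------------ scalar facts
  have huz : u = (2 : ℚ) ^ (-(q : ℤ)) := unitRoundoff_eq_zpow q
  have hu0 : 0 < u := by rw [huz]; exact zpow_pos (by norm_num) _
  have hm0 : 0 < m := zpow_pos (by norm_num) _
  have ht0 : 0 < t := zpow_pos (by norm_num) _
  have two_mul_zpow : ∀ e : ℤ, (2 : ℚ) * (2 : ℚ) ^ e = (2 : ℚ) ^ (e + 1) := fun e => by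
    rw [zpow_add_one₀ (by norm_num)]; ring
  have hmu : 2 * u ≤ m := by
    rw [huz, hmdef, two_mul_zpow]; exact zpow_le_zpow_right₀ (by norm_num) (by omega)
  have htm : 2 * m ≤ t := by
    rw [htdef, hmdef, two_mul_zpow]; exact zpow_le_zpow_right₀ (by norm_num) (by omega)
  have ht4 : t ≤ 1 / 4 := by
    rw [htdef]
    have : (2 : ℚ) ^ (-(j : ℤ)) ≤ (2 : ℚ) ^ (-2 : ℤ) := zpow_le_zpow_right₀ (by norm_num) (by omega)
    have e : (2 : ℚ) ^ (-2 : ℤ) = 1 / 4 := by norm_num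
    rwa [e] at this
  have hu1 : u ≤ 1 := unitRoundoff_le_one q
  have pw : ∀ a b : ℤ, (2 : ℚ) ^ a * (2 : ℚ) ^ b = (2 : ℚ) ^ (a + b) := fun a b =>
    (zpow_add₀ (by norm_num) a b).symm
  have hcm : m * (2 : ℚ) ^ (-(c : ℤ)) = u := by rw [hmdef, huz, pw]; congr 1; omega
  have htd : t * (2 : ℚ) ^ (-(d : ℤ)) = u := by rw [htdef, huz, pw]; congr 1; omega
  have htkj : t * (2 : ℚ) ^ (-((k : ℤ) - j)) = m := by rw [htdef, hmdef, pw]; congr 1; ring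
  have h2m : (2 : ℚ) ^ (-((k : ℤ) - 1)) = 2 * m := by rw [hmdef, two_mul_zpow]; congr 1; ring
  have h2t : (2 : ℚ) ^ (-((j : ℤ) - 1)) = 2 * t := by rw [htdef, two_mul_zpow]; congr 1; ring
  have hhalf : (2 : ℚ) ^ (-1 : ℤ) * 2 = 1 := by norm_num
  have hc1s : (2 : ℚ) ^ (-((c : ℤ) + 1)) * 2 = (2 : ℚ) ^ (-(c : ℤ)) := by
    rw [mul_comm, two_mul_zpow]; congr 1; ring
  have hcjm : m * (2 : ℚ) ^ (-((c : ℤ) + j)) = u * t := by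
    rw [hmdef, huz, htdef, pw, pw]; congr 1; omega
  ------------------------------------------------------------------ per-child rows
  have n0 : ∀ (X : SumTree) (S : Finset ℤ), 0 ≤ treeBR q X S := fun X S => treeBR_nonneg q X S
  have rTR : Routable q ({0, -((k : ℤ) - j), -(d : ℤ)} : Finset ℤ) := by
    intro x hx y hy
    simp only [Finset.mem_insert, Finset.mem_singleton] at hx hy
    rcases hx with rfl | rfl | rfl <;> rcases hy with rfl | rfl | rfl <;> omega
  have rowM0j : ∀ X : SumTree, 0 ≤ (-1) * treeBR q X {0} + (1) * treeBR q X {0, -(j : ℤ)} := by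
    intro X
    have h := treeBR_le_of_subset hq1 X (B := ({0} : Finset ℤ)) (C := ({0, -(j : ℤ)} : Finset ℤ))
      (by intro z hz; rw [Finset.mem_singleton] at hz; simp [hz]) (routable_zero_pair (by omega) (by omega))
    linarith only [h]
  have rowM0cj : ∀ X : SumTree, 0 ≤ (-1) * treeBR q X {0} + (1) * treeBR q X {0, -((c : ℤ) + j)} := by
    intro X
    have h := treeBR_le_of_subset hq1 X (B := ({0} : Finset ℤ)) (C := ({0, -((c : ℤ) + j)} : Finset ℤ))
      (by intro z hz; rw [Finset.mem_singleton] at hz; simp [hz]) (routable_zero_pair (by omega) (by omega))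
    linarith only [h]
  have rowMkj : ∀ X : SumTree, 0 ≤ (-1) * treeBR q X {0, -((k : ℤ) - j)} + (1) * treeBR q X {0, -((k : ℤ) - j), -(d : ℤ)} := by
    intro X
    have h := treeBR_le_of_subset hq1 X (B := ({0, -((k : ℤ) - j)} : Finset ℤ))
      (C := ({0, -((k : ℤ) - j), -(d : ℤ)} : Finset ℤ))
      (by
        intro z hz
        simp only [Finset.mem_insert, Finset.mem_singleton] at hz ⊢
        rcases hz with h | h
        · exact Or.inl h
        · exact Or.inr (Or.inl h)) rTR
    linarith only [h]
  have rowMC2 : ∀ X : SumTree, 0 ≤ (-2) * treeBR q X {0, -((k : ℤ) - j), -((d : ℤ) + 1)} +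
      (1) * treeBR q X {0, -((k : ℤ) - j), -(d : ℤ)} + (1) * treeBR q X {0, -((k : ℤ) - j)} := by
    intro X
    have h := two_treeBR_triple_le (q := q) X (s := k - j) (i := d + 1) (by omega) (by omega) (by omega)
    have e1 : ({0, -((k - j : ℕ) : ℤ), -((d + 1 : ℕ) : ℤ)} : Finset ℤ) = {0, -((k : ℤ) - j), -((d : ℤ) + 1)} := by
      ext z; simp only [Finset.mem_insert, Finset.mem_singleton]; omega
    have e2 : ({0, -((k - j : ℕ) : ℤ), -(((d + 1 : ℕ) : ℤ) - 1)} : Finset ℤ) = {0, -((k : ℤ) - j), -(d : ℤ)} := by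
      ext z; simp only [Finset.mem_insert, Finset.mem_singleton]; omega
    have e3 : ({0, -((k - j : ℕ) : ℤ)} : Finset ℤ) = {0, -((k : ℤ) - j)} := by
      ext z; simp only [Finset.mem_insert, Finset.mem_singleton]; omega
    rw [e1, e2, e3] at h
    linarith only [h]
  have rowMCc : ∀ X : SumTree, 0 ≤ (-2) * treeBR q X {0, -((c : ℤ) + 1)} + (1) * treeBR q X {0, -(c : ℤ)} +
      (1) * treeBR q X {0} := by
    intro X
    have h := two_treeBR_pair_le (q := q) X (e := -((c : ℤ) + 1)) (by omega) (by omega)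
    rw [show -((c : ℤ) + 1) + 1 = -(c : ℤ) by ring] at h
    linarith only [h]
  have rowMCd : ∀ X : SumTree, 0 ≤ (-2) * treeBR q X {0, -((d : ℤ) + 1)} + (1) * treeBR q X {0, -(d : ℤ)} +
      (1) * treeBR q X {0} := by
    intro X
    have h := two_treeBR_pair_le (q := q) X (e := -((d : ℤ) + 1)) (by omega) (by omega)
    rw [show -((d : ℤ) + 1) + 1 = -(d : ℤ) by ring] at h
    linarith only [h]
  have rowR31 : ∀ X : SumTree, 0 ≤ (-1) * treeBR q X {0, -((j : ℤ) - 1)} + (1 - u) * treeBR q X {0, -(j : ℤ)} +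
      (t + u*t) * treeBR q X {0, -(d : ℤ)} := by
    intro X
    have h := treeBR_twoFam_le (by omega : 3 ≤ q) (j := j) hj (by omega) X
    have e1 : treeBR q X {-1, -(j : ℤ)} = (2 : ℚ) ^ (-1 : ℤ) * treeBR q X {0, -((j : ℤ) - 1)} := by
      rw [← treeBR_pair_shift X (-1) (-((j : ℤ) - 1))]; congr 1; ext z; simp; omega
    have e2 : treeBR q X {-(j : ℤ), -(q : ℤ)} = t * treeBR q X {0, -(d : ℤ)} := by
      rw [htdef, ← treeBR_pair_shift X (-(j : ℤ)) (-(d : ℤ))]; congr 1; ext z; simp; omega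
    rw [e1, e2, ← hudef] at h
    have e3 : 2 * ((2 : ℚ) ^ (-1 : ℤ) * treeBR q X {0, -((j : ℤ) - 1)}) = treeBR q X {0, -((j : ℤ) - 1)} := by
      rw [← mul_assoc, mul_comm (2 : ℚ), hhalf, one_mul]
    rw [e3] at h
    linarith only [h]
  have rowGC : ∀ X : SumTree, 0 ≤ (-2*u + 2*u*t) * treeBR q X {0, -((c : ℤ) + 1)} + (u) * treeBR q X {0, -((c : ℤ) + j)} +
      (u - 2*u*t) * treeBR q X {0, -(c : ℤ)} := by
    intro X
    have h := treeBR_gc_pair (q := q) X (j := c + j) (c := c) hc1 (by omega) (by omega)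
    have e0 : ({0, -((c + j : ℕ) : ℤ)} : Finset ℤ) = {0, -((c : ℤ) + j)} := by push_cast; rfl
    have e0' : (2 : ℚ) ^ (-((c + j : ℕ) : ℤ)) = (2 : ℚ) ^ (-((c : ℤ) + j)) := by push_cast; rfl
    rw [e0, e0'] at h
    have h' := mul_le_mul_of_nonneg_left h (by positivity : (0 : ℚ) ≤ 2 * m)
    have es : 2 * m * (2 : ℚ) ^ (-(c : ℤ)) = 2 * u := by rw [mul_assoc, hcm]
    have es1 : 2 * m * (2 : ℚ) ^ (-((c : ℤ) + 1)) = u := by rw [← hcm, ← hc1s]; ring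
    have esj : 2 * m * (2 : ℚ) ^ (-((c : ℤ) + j)) = 2 * (u * t) := by rw [mul_assoc, hcjm]
    have e1 : 2 * m * ((((2 : ℚ) ^ (-(c : ℤ))) - (2 : ℚ) ^ (-((c : ℤ) + j))) * treeBR q X {0, -((c : ℤ) + 1)}) =
        (2 * m * (2 : ℚ) ^ (-(c : ℤ)) - 2 * m * (2 : ℚ) ^ (-((c : ℤ) + j))) * treeBR q X {0, -((c : ℤ) + 1)} := by ring
    have e2 : 2 * m * ((((2 : ℚ) ^ (-((c : ℤ) + 1))) - (2 : ℚ) ^ (-((c : ℤ) + j))) * treeBR q X {0, -(c : ℤ)} +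
        ((2 : ℚ) ^ (-(c : ℤ)) - (2 : ℚ) ^ (-((c : ℤ) + 1))) * treeBR q X {0, -((c : ℤ) + j)}) =
        (2 * m * (2 : ℚ) ^ (-((c : ℤ) + 1)) - 2 * m * (2 : ℚ) ^ (-((c : ℤ) + j))) * treeBR q X {0, -(c : ℤ)} +
          (2 * m * (2 : ℚ) ^ (-(c : ℤ)) - 2 * m * (2 : ℚ) ^ (-((c : ℤ) + 1))) * treeBR q X {0, -((c : ℤ) + j)} := by
      ring
    rw [e1, e2, es, es1, esj] at h'
    linarith only [h']
  have rowPhi3 : ∀ X : SumTree, 0 ≤ (-1) * treeBR q X {0, -((k : ℤ) - 1)} + (1 - u) * treeBR q X {0, -(k : ℤ)} +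
      (m) * treeBR q X {0, -(c : ℤ), -((c : ℤ) + j)} + (u*m) * treeBR q X {0, -((c : ℤ) + j)} := by
    intro X
    have h := treeBR_phi3 hq hj hjk hkq X
    rw [← hc, ← hudef, ← hmdef] at h
    linarith only [h]
  -- options at a node (lower bounds of the right-hand node values)
  have optJK : ∀ A B : SumTree,
      1 + ((1) * treeBR q A {0, -(j : ℤ), -(k : ℤ)} + (u) * treeBR q B {0}) ≤ treeBR q (.node A B) {0, -(j : ℤ), -(k : ℤ)} ∧
      1 + ((1) * treeBR q A {0, -(j : ℤ)} + (m) * treeBR q B {0, -(c : ℤ)}) ≤ treeBR q (.node A B) {0, -(j : ℤ), -(k : ℤ)} ∧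
      1 + ((1) * treeBR q A {0, -(k : ℤ)} + (t) * treeBR q B {0, -(d : ℤ)}) ≤ treeBR q (.node A B) {0, -(j : ℤ), -(k : ℤ)} ∧
      1 + ((1) * treeBR q A {0} + (t) * treeBR q B {0, -((k : ℤ) - j), -(d : ℤ)}) ≤
        treeBR q (.node A B) {0, -(j : ℤ), -(k : ℤ)} := by
    intro A B
    obtain ⟨s1, s2, s3, s4⟩ := treeBR_triple_node_ge hq1 A B (a := j) (b := k) (by omega) hjk hkq
    have e1 : treeBR q B {-(q : ℤ)} = u * treeBR q B {0} := by rw [treeBR_single_shift, huz]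
    have e2 : treeBR q B {-(k : ℤ), -(q : ℤ)} = m * treeBR q B {0, -(c : ℤ)} := by
      rw [hmdef, ← treeBR_pair_shift B (-(k : ℤ)) (-(c : ℤ))]; congr 1; ext z; simp; omega
    have e3 : treeBR q B {-(j : ℤ), -(q : ℤ)} = t * treeBR q B {0, -(d : ℤ)} := by
      rw [htdef, ← treeBR_pair_shift B (-(j : ℤ)) (-(d : ℤ))]; congr 1; ext z; simp; omega
    have e4 : treeBR q B {-(j : ℤ), -(k : ℤ), -(q : ℤ)} = t * treeBR q B {0, -((k : ℤ) - j), -(d : ℤ)} := by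
      rw [htdef, ← treeBR_triple_shift B (-(j : ℤ)) (-((k : ℤ) - j)) (-(d : ℤ))]; congr 1; ext z; simp; omega
    rw [e1] at s1; rw [e2] at s2; rw [e3] at s3; rw [e4] at s4
    exact ⟨by linarith only [s1], by linarith only [s2], by linarith only [s3], by linarith only [s4]⟩
  have optR : ∀ A B : SumTree,
      1 + ((1) * treeBR q A {0, -((k : ℤ) - j), -(d : ℤ)} + (u) * treeBR q B {0}) ≤
        treeBR q (.node A B) {0, -((k : ℤ) - j), -(d : ℤ)} ∧
      (t) + ((t) * treeBR q A {0, -((k : ℤ) - j)} + (u) * treeBR q B {0, -(j : ℤ)}) ≤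
        (t) * treeBR q (.node A B) {0, -((k : ℤ) - j), -(d : ℤ)} ∧
      (t) + ((t) * treeBR q A {0, -(d : ℤ)} + (m) * treeBR q B {0, -((c : ℤ) + j)}) ≤
        (t) * treeBR q (.node A B) {0, -((k : ℤ) - j), -(d : ℤ)} ∧
      (t) + ((t) * treeBR q A {0} + (m) * treeBR q B {0, -(c : ℤ), -((c : ℤ) + j)}) ≤
        (t) * treeBR q (.node A B) {0, -((k : ℤ) - j), -(d : ℤ)} := by
    intro A B
    obtain ⟨s1, s2, s3, s4⟩ := treeBR_triple_node_ge hq1 A B (a := k - j) (b := d) (by omega) (by omega) (by omega)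
    have e0 : ({0, -((k - j : ℕ) : ℤ), -(d : ℤ)} : Finset ℤ) = {0, -((k : ℤ) - j), -(d : ℤ)} := by
      ext z; simp only [Finset.mem_insert, Finset.mem_singleton]; omega
    have e0' : ({0, -((k - j : ℕ) : ℤ)} : Finset ℤ) = {0, -((k : ℤ) - j)} := by
      ext z; simp only [Finset.mem_insert, Finset.mem_singleton]; omega
    rw [e0] at s1 s2 s3 s4; rw [e0'] at s2
    have e1 : treeBR q B {-(q : ℤ)} = u * treeBR q B {0} := by rw [treeBR_single_shift, huz]
    have e2 : treeBR q B {-(d : ℤ), -(q : ℤ)} = (2 : ℚ) ^ (-(d : ℤ)) * treeBR q B {0, -(j : ℤ)} := by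
      rw [← treeBR_pair_shift B (-(d : ℤ)) (-(j : ℤ))]; congr 1; ext z; simp; omega
    have e3 : treeBR q B {-((k - j : ℕ) : ℤ), -(q : ℤ)} = (2 : ℚ) ^ (-((k : ℤ) - j)) * treeBR q B {0, -((c : ℤ) + j)} := by
      rw [← treeBR_pair_shift B (-((k : ℤ) - j)) (-((c : ℤ) + j))]; congr 1; ext z; simp; omega
    have e4 : treeBR q B {-((k - j : ℕ) : ℤ), -(d : ℤ), -(q : ℤ)} =
        (2 : ℚ) ^ (-((k : ℤ) - j)) * treeBR q B {0, -(c : ℤ), -((c : ℤ) + j)} := by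
      rw [← treeBR_triple_shift B (-((k : ℤ) - j)) (-(c : ℤ)) (-((c : ℤ) + j))]; congr 1; ext z; simp; omega
    rw [e1] at s1; rw [e2] at s2; rw [e3] at s3; rw [e4] at s4
    refine ⟨by linarith only [s1], ?_, ?_, ?_⟩
    · have s2' := mul_le_mul_of_nonneg_left s2 ht0.le
      have ee : t * (1 + (treeBR q A {0, -((k : ℤ) - j)} + (2 : ℚ) ^ (-(d : ℤ)) * treeBR q B {0, -(j : ℤ)})) =
          t + (t * treeBR q A {0, -((k : ℤ) - j)} + (t * (2 : ℚ) ^ (-(d : ℤ))) * treeBR q B {0, -(j : ℤ)}) := by ring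
      rw [ee, htd] at s2'
      linarith only [s2']
    · have s3' := mul_le_mul_of_nonneg_left s3 ht0.le
      have ee : t * (1 + (treeBR q A {0, -(d : ℤ)} + (2 : ℚ) ^ (-((k : ℤ) - j)) * treeBR q B {0, -((c : ℤ) + j)})) =
          t + (t * treeBR q A {0, -(d : ℤ)} + (t * (2 : ℚ) ^ (-((k : ℤ) - j))) * treeBR q B {0, -((c : ℤ) + j)}) := by ring
      rw [ee, htkj] at s3'
      linarith only [s3']
    · have s4' := mul_le_mul_of_nonneg_left s4 ht0.le
      have ee : t * (1 + (treeBR q A {0} + (2 : ℚ) ^ (-((k : ℤ) - j)) * treeBR q B {0, -(c : ℤ), -((c : ℤ) + j)})) =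
          t + (t * treeBR q A {0} + (t * (2 : ℚ) ^ (-((k : ℤ) - j))) * treeBR q B {0, -(c : ℤ), -((c : ℤ) + j)}) := by ring
      rw [ee, htkj] at s4'
      linarith only [s4']
  -- symmetry of the node
  have comm : ∀ (A B : SumTree) (S : Finset ℤ), treeBR q (.node B A) S = treeBR q (.node A B) S :=
    fun A B S => by unfold treeBR; exact treeBRw_node_comm q _ B A S
  ------------------------------------------------------------------ the induction
  intro tr
  induction tr with
  | leaf z => simp [treeBR]
  | node A B ihA ihB =>
    set NJK := treeBR q (.node A B) {0, -(j : ℤ), -(k : ℤ)} with hNJK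
    set NR := treeBR q (.node A B) {0, -((k : ℤ) - j), -(d : ℤ)} with hNR
    obtain ⟨oJK0ab, oJK2ab, oJK3ab, oJK1ab⟩ := optJK A B
    obtain ⟨oJK0ba, oJK2ba, oJK3ba, oJK1ba⟩ := optJK B A
    obtain ⟨oR0ab, oR2ab, oR3ab, oR1ab⟩ := optR A B
    obtain ⟨oR0ba, oR2ba, oR3ba, oR1ba⟩ := optR B A
    rw [comm] at oJK0ba oJK2ba oJK3ba oJK1ba oR0ba oR2ba oR3ba oR1ba
    -- the induction hypotheses as rows
    have ihA' : 0 ≤ (-1) * treeBR q A {0, -((j : ℤ) - 1), -((k : ℤ) - 1)} + (1 - u) * treeBR q A {0, -(j : ℤ), -(k : ℤ)} +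
        (t + u*t) * treeBR q A {0, -((k : ℤ) - j), -(d : ℤ)} := by linarith only [ihA]
    have ihB' : 0 ≤ (-1) * treeBR q B {0, -((j : ℤ) - 1), -((k : ℤ) - 1)} + (1 - u) * treeBR q B {0, -(j : ℤ), -(k : ℤ)} +
        (t + u*t) * treeBR q B {0, -((k : ℤ) - j), -(d : ℤ)} := by linarith only [ihB]
    -- R ≥ 0
    have hRHS : (1 - u) * NJK + (t + u*t) * NR = (1 - u) * NJK + (1 + u) * t * NR := by ring
    have hR : 0 ≤ (1 - u) * NJK + (1 + u) * t * NR - 1 := by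
      have h1 : 1 ≤ NJK := by linarith only [oJK0ab, n0 A {0, -(j : ℤ), -(k : ℤ)}, mul_nonneg hu0.le (n0 B {0})]
      have h2 : 1 ≤ NR := by linarith only [oR0ab, n0 A {0, -((k : ℤ) - j), -(d : ℤ)}, mul_nonneg hu0.le (n0 B {0})]
      have h4 := mul_le_mul_of_nonneg_left h1 (by linarith only [hu1] : (0 : ℚ) ≤ 1 - u)
      have h5 := mul_le_mul_of_nonneg_left h2 (by positivity : (0 : ℚ) ≤ (1 + u) * t)
      linarith only [h4, h5, hmu, htm, hu0, mul_nonneg hu0.le ht0.le]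
    have ha' : ((j - 1 : ℕ) : ℤ) = (j : ℤ) - 1 := by omega
    have hb' : ((k - 1 : ℕ) : ℤ) = (k : ℤ) - 1 := by omega
    have key := treeBR_three_node_le hq1 A B (a := j - 1) (b := k - 1) (by omega) (by omega) (by omega) hR ?_
    · rw [ha', hb'] at key; linarith only [key]
    rw [ha', hb']
    -- shifts of the raw option expressions
    have eq1 : ∀ X : SumTree, treeBR q X {-(q : ℤ)} = u * treeBR q X {0} := fun X => by
      rw [treeBR_single_shift, huz]
    have eq2 : ∀ X : SumTree, treeBR q X {-((k : ℤ) - 1), -(q : ℤ)} = 2 * m * treeBR q X {0, -((c : ℤ) + 1)} := fun X => by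
      rw [← h2m, ← treeBR_pair_shift X (-((k : ℤ) - 1)) (-((c : ℤ) + 1))]; congr 1; ext z; simp; omega
    have eq3 : ∀ X : SumTree, treeBR q X {-((j : ℤ) - 1), -(q : ℤ)} = 2 * t * treeBR q X {0, -((d : ℤ) + 1)} := fun X => by
      rw [← h2t, ← treeBR_pair_shift X (-((j : ℤ) - 1)) (-((d : ℤ) + 1))]; congr 1; ext z; simp; omega
    have eq4 : ∀ X : SumTree, treeBR q X {-((j : ℤ) - 1), -((k : ℤ) - 1), -(q : ℤ)} =
        2 * t * treeBR q X {0, -((k : ℤ) - j), -((d : ℤ) + 1)} := fun X => by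
      rw [← h2t, ← treeBR_triple_shift X (-((j : ℤ) - 1)) (-((k : ℤ) - j)) (-((d : ℤ) + 1))]
      congr 1; ext z; simp; omega
    rw [eq1, eq1, eq2, eq2, eq3, eq3, eq4, eq4]
    -- the eight branches
    have b4 := eRow2_branch4 hu0 hmu htm ht4 oJK0ab oR0ab ihA' (n0 B {0})
    have b4' := eRow2_branch4 hu0 hmu htm ht4 oJK0ba oR0ba ihB' (n0 A {0})
    have b1 := eRow2_branch1 hu0 hmu htm ht4 oJK1ab oR2ba oR0ba (rowM0j A) (rowMC2 B) (rowMkj B)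
    have b1' := eRow2_branch1 hu0 hmu htm ht4 oJK1ba oR2ab oR0ab (rowM0j B) (rowMC2 A) (rowMkj A)
    have b2 := eRow2_branch2 hu0 hmu htm ht4 oJK2ab oR3ab (rowR31 A) (rowMCc B) (rowGC B) (rowM0cj B)
    have b2' := eRow2_branch2 hu0 hmu htm ht4 oJK2ba oR3ba (rowR31 B) (rowMCc A) (rowGC A) (rowM0cj A)
    have b3 := eRow2_branch3 hu0 hmu htm ht4 oJK3ab oR1ba oR3ba (rowPhi3 A) (rowMCd B)
    have b3' := eRow2_branch3 hu0 hmu htm ht4 oJK3ba oR1ab oR3ab (rowPhi3 B) (rowMCd A)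
    rw [hRHS] at b4 b4' b1 b1' b2 b2' b3 b3'
    refine max_le (max_le (max_le ?_ ?_) (max_le ?_ ?_)) (max_le (max_le ?_ ?_) (max_le ?_ ?_))
    · linarith only [b4]
    · linarith only [b2]
    · linarith only [b3]
    · linarith only [b1]
    · linarith only [b4']
    · linarith only [b2']
    · linarith only [b3']
    · linarith only [b1']

end R33

end Summit.Ventures.CertifiedArithmetic.LowPrec.Opt
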